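import Summits.QuantumFields.YangMills.Theorems.AllWindowsColdBoxBoxHighLineTripleBond
import Mathlib.Algebra.Order.Chebyshev

/-!
# T-S5.12a, part 3 — the `gaussAvg` calculus of the chart Gaussian and the TENTH MOMENTS of the edge variables

Planner ym-idea-2 g18's `TaskS5Step2Wick.lean` (✓`…Step2Wick`): `gaussAvg β H F = (∫ F·gaussWeight)/(∫ gaussWeight)`.  For the remainder half of 12a
`CubicVariance` (quintic Taylor remainder of the plaquette cost, `|R_p| ≲ max_i ‖v_i‖⁵` uniformly) the assembly needs:

* §1 the `gaussAvg` calculus: `integral_gaussWeight_pos`, `gaussAvg_mono_of_nonneg` (pointwise domination by an integrable majorant, NO measurability of the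
  minorant), `gaussAvg_add`, `gaussAvg_const_mul`, `gaussAvg_finset_sum`, `gaussAvg_nonneg`;
* §2 measurability / integrability of coordinate functionals against `gaussWeight` (`measurable_coord`, `integrable_coord_pow_mul_gaussWeight`,
  `integrable_norm_pow_ten_mul_gaussWeight`);
* §3 ★ the tenth moments: `gaussAvg_coord_pow_ten_eq` (`E₀[(a_e^c)¹⁰] = 945·((2β)⁻¹G_H(e,e))⁵`, Wick with ten equal legs, ✓`pairingSum_const`) and
  ★`gaussAvg_norm_pow_ten_le` (`E₀‖a_e‖¹⁰ ≤ C/β⁵` for `H ≥ 1`, Jensen `(Σ_c x_c²)⁵ ≤ 3⁴Σ_c x_c¹⁰` + ✓S3a via `coldBox_propagator_diag`).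

Tree (✓TripleBond chain, ✓Step2Wick) + Mathlib; no definitions.  HONEST LABEL: bookkeeping for 12a/10 of STEP 2 of the XL stub S5 of a critic-PASSed DRAFT line; 7a, 12a, 10,
T-S5.13/S5, U5, ⟨24004⟩ ⟨24335⟩ ⟨24336⟩ remain OPEN; route AllWindowsColdBox is DRAFT; no rung is proved; the Yang–Mills mass gap is NOT proved by this file.
Seat ym-line-sfw-p2 g77 (LEAD, cell ym-idea-1; Wick layer T-S5.10/11/12a).
-/

set_option autoImplicit false

noncomputable section

open MeasureTheory Matrix Finset
open scoped Kronecker Nat Matrix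
open Literature.Probability.LatticeModels (pairingSum)

namespace Summit.QuantumFields.YangMills.Theorems.AllWindowsColdBoxBoxHighLine

namespace EdgeChartGaussian

open LaplaceSandwich (flatten flatten_apply volume_preserving_flatten)

/-! ## §1 The `gaussAvg` calculus -/

/-- The normalising integral `∫ gaussWeight` is the Wick engine's partition function (definitional). -/
theorem integral_gaussWeight_eq (β : ℝ) (H : ℕ) :
    (∫ a : LandauFree H → E3, gaussWeight β H a) =
      ∫ a : LandauFree H → E3, Real.exp (-(β * ∑ c : Fin 3, (fun e => a e c) ⬝ᵥ (hodgeQ H *ᵥ fun e => a e c))) := rfl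

/-- `0 < ∫ gaussWeight` for `β > 0`. -/
theorem integral_gaussWeight_pos (H : ℕ) {β : ℝ} (hβ : 0 < β) : 0 < ∫ a : LandauFree H → E3, gaussWeight β H a := by
  rw [integral_gaussWeight_eq]
  exact integral_exp_neg_colourForm_pos (hodgeQ H) (hodgeQ_posDef H) hβ (I := LandauFree H)

/-- `0 < gaussWeight`. -/
theorem gaussWeight_pos (β : ℝ) (H : ℕ) (a : LandauFree H → E3) : 0 < gaussWeight β H a := Real.exp_pos _

/-- `gaussWeight` is integrable for `β > 0`. -/
theorem integrable_gaussWeight (H : ℕ) {β : ℝ} (hβ : 0 < β) : Integrable (fun a : LandauFree H → E3 => gaussWeight β H a) := by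
  refine (integrable_prodCoord_mul_exp_colourForm' (hodgeQ H) (hodgeQ_posDef H) hβ (m := 0) (fun i => Fin.elim0 i)).congr ?_
  refine Filter.Eventually.of_forall fun a => ?_
  simp only [Finset.univ_eq_empty, Finset.prod_empty, one_mul]
  rfl

/-- ★ **Monotonicity by domination**: `0 ≤ F ≤ G` pointwise and `G·gaussWeight` integrable ⇒ `gaussAvg F ≤ gaussAvg G` (no measurability of `F` needed). -/
theorem gaussAvg_mono_of_nonneg (H : ℕ) {β : ℝ} (hβ : 0 < β) {F G : (LandauFree H → E3) → ℝ} (hF : ∀ a, 0 ≤ F a) (hFG : ∀ a, F a ≤ G a)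
    (hG : Integrable (fun a => G a * gaussWeight β H a)) : gaussAvg β H F ≤ gaussAvg β H G := by
  unfold gaussAvg
  refine div_le_div_of_nonneg_right ?_ (integral_gaussWeight_pos H hβ).le
  refine integral_mono_of_nonneg (Filter.Eventually.of_forall fun a => ?_) hG (Filter.Eventually.of_forall fun a => ?_)
  · exact mul_nonneg (hF a) (gaussWeight_pos β H a).le
  · exact mul_le_mul_of_nonneg_right (hFG a) (gaussWeight_pos β H a).le

/-- Monotonicity between integrable observables. -/
theorem gaussAvg_mono (H : ℕ) {β : ℝ} (hβ : 0 < β) {F G : (LandauFree H → E3) → ℝ} (hFG : ∀ a, F a ≤ G a)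
    (hF : Integrable (fun a => F a * gaussWeight β H a)) (hG : Integrable (fun a => G a * gaussWeight β H a)) :
    gaussAvg β H F ≤ gaussAvg β H G := by
  unfold gaussAvg
  refine div_le_div_of_nonneg_right ?_ (integral_gaussWeight_pos H hβ).le
  exact integral_mono hF hG fun a => mul_le_mul_of_nonneg_right (hFG a) (gaussWeight_pos β H a).le

/-- `gaussAvg` of a pointwise-nonnegative observable is nonnegative. -/
theorem gaussAvg_nonneg (H : ℕ) {β : ℝ} (hβ : 0 < β) {F : (LandauFree H → E3) → ℝ} (hF : ∀ a, 0 ≤ F a) : 0 ≤ gaussAvg β H F := by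
  unfold gaussAvg
  exact div_nonneg (integral_nonneg fun a => mul_nonneg (hF a) (gaussWeight_pos β H a).le) (integral_gaussWeight_pos H hβ).le

/-- Additivity. -/
theorem gaussAvg_add (β : ℝ) (H : ℕ) {F G : (LandauFree H → E3) → ℝ} (hF : Integrable (fun a => F a * gaussWeight β H a))
    (hG : Integrable (fun a => G a * gaussWeight β H a)) :
    gaussAvg β H (fun a => F a + G a) = gaussAvg β H F + gaussAvg β H G := by
  unfold gaussAvg
  rw [← add_div]
  congr 1
  simp_rw [add_mul]
  exact integral_add hF hG

/-- Homogeneity. -/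
theorem gaussAvg_const_mul (β : ℝ) (H : ℕ) (c : ℝ) (F : (LandauFree H → E3) → ℝ) :
    gaussAvg β H (fun a => c * F a) = c * gaussAvg β H F := by
  unfold gaussAvg
  simp_rw [mul_assoc]
  rw [integral_const_mul, mul_div_assoc]

/-- Finite sums. -/
theorem gaussAvg_finset_sum (β : ℝ) (H : ℕ) {κ : Type*} (s : Finset κ) (F : κ → (LandauFree H → E3) → ℝ)
    (hF : ∀ i ∈ s, Integrable (fun a => F i a * gaussWeight β H a)) :
    gaussAvg β H (fun a => ∑ i ∈ s, F i a) = ∑ i ∈ s, gaussAvg β H (F i) := by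
  unfold gaussAvg
  simp_rw [Finset.sum_mul]
  rw [integral_finsetSum _ hF, Finset.sum_div]

/-- The Wick engine form of a `gaussAvg`: `gaussAvg β H F = (∫ F · e^{−βQ}) / Z`. -/
theorem gaussAvg_eq (β : ℝ) (H : ℕ) (F : (LandauFree H → E3) → ℝ) :
    gaussAvg β H F = (∫ a : LandauFree H → E3, F a * Real.exp (-(β * ∑ c : Fin 3, (fun e => a e c) ⬝ᵥ (hodgeQ H *ᵥ fun e => a e c)))) /
      ∫ a : LandauFree H → E3, Real.exp (-(β * ∑ c : Fin 3, (fun e => a e c) ⬝ᵥ (hodgeQ H *ᵥ fun e => a e c))) := rfl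

/-! ## §2 Measurability and integrability of coordinate functionals -/

/-- A colour component `a ↦ (a e)_c` is measurable (it is a coordinate of ✓`flatten`). -/
theorem measurable_coord {H : ℕ} (e : LandauFree H) (c : Fin 3) : Measurable fun a : LandauFree H → E3 => a e c :=
  (measurable_pi_apply (e, c)).comp (flatten (LandauFree H)).measurable

/-- `a ↦ ‖a e‖` is measurable. -/
theorem measurable_norm_apply {H : ℕ} (e : LandauFree H) : Measurable fun a : LandauFree H → E3 => ‖a e‖ :=
  (measurable_pi_apply e).norm

/-- `gaussWeight` is (ae strongly) measurable. -/
theorem aestronglyMeasurable_gaussWeight (H : ℕ) {β : ℝ} (hβ : 0 < β) :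
    AEStronglyMeasurable (fun a : LandauFree H → E3 => gaussWeight β H a) :=
  (integrable_gaussWeight H hβ).aestronglyMeasurable

/-- `(a_e^c)^n · gaussWeight` is integrable. -/
theorem integrable_coord_pow_mul_gaussWeight (H : ℕ) {β : ℝ} (hβ : 0 < β) (e : LandauFree H) (c : Fin 3) (n : ℕ) :
    Integrable (fun a : LandauFree H → E3 => a e c ^ n * gaussWeight β H a) := by
  have h := integrable_prodCoord_mul_exp_colourForm' (hodgeQ H) (hodgeQ_posDef H) hβ (m := n) (fun _ => (e, c))
  refine h.congr (Filter.Eventually.of_forall fun a => ?_)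
  simp only [Finset.prod_const, Finset.card_univ, Fintype.card_fin]
  rfl

/-- Jensen for the Euclidean norm on `ℝ³`: `‖x‖¹⁰ ≤ 81 · Σ_c x_c¹⁰`. -/
theorem norm_pow_ten_le (x : E3) : ‖x‖ ^ 10 ≤ 81 * ∑ c : Fin 3, x c ^ 10 := by
  have hsq : ‖x‖ ^ 2 = ∑ c : Fin 3, x c ^ 2 := by
    rw [EuclideanSpace.norm_sq_eq]
    exact Finset.sum_congr rfl fun c _ => by rw [Real.norm_eq_abs, sq_abs]
  have h := pow_sum_le_card_mul_sum_pow (s := (Finset.univ : Finset (Fin 3))) (f := fun c => x c ^ 2) (fun c _ => sq_nonneg _) 4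
  simp only [Finset.card_univ, Fintype.card_fin] at h
  calc ‖x‖ ^ 10 = (‖x‖ ^ 2) ^ 5 := by ring
    _ = (∑ c : Fin 3, x c ^ 2) ^ 5 := by rw [hsq]
    _ ≤ (3 : ℝ) ^ 4 * ∑ c : Fin 3, (x c ^ 2) ^ 5 := by exact_mod_cast h
    _ = 81 * ∑ c : Fin 3, x c ^ 10 := by norm_num; exact Finset.sum_congr rfl fun c _ => by ring

/-- `‖a e‖¹⁰ · gaussWeight` is integrable (dominated by `81 Σ_c (a_e^c)¹⁰ · gaussWeight`). -/
theorem integrable_norm_pow_ten_mul_gaussWeight (H : ℕ) {β : ℝ} (hβ : 0 < β) (e : LandauFree H) :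
    Integrable (fun a : LandauFree H → E3 => ‖a e‖ ^ 10 * gaussWeight β H a) := by
  have hdom : Integrable (fun a : LandauFree H → E3 => (81 * ∑ c : Fin 3, a e c ^ 10) * gaussWeight β H a) := by
    have h := integrable_finsetSum (Finset.univ : Finset (Fin 3)) fun c _ => (integrable_coord_pow_mul_gaussWeight H hβ e c 10).const_mul 81
    refine h.congr (Filter.Eventually.of_forall fun a => ?_)
    simp only [Finset.mul_sum, mul_assoc, Finset.sum_mul]
  refine hdom.mono' (((measurable_norm_apply e).pow_const 10).aestronglyMeasurable.mul (aestronglyMeasurable_gaussWeight H hβ)) ?_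
  refine Filter.Eventually.of_forall fun a => ?_
  rw [Real.norm_eq_abs, abs_of_nonneg (mul_nonneg (pow_nonneg (norm_nonneg _) _) (gaussWeight_pos β H a).le)]
  exact mul_le_mul_of_nonneg_right (norm_pow_ten_le (a e)) (gaussWeight_pos β H a).le

/-! ## §3 Tenth moments -/

/-- ★ **Exact tenth moment of a colour component**: `E₀[(a_e^c)¹⁰] = 945 · ((2β)⁻¹ · G_H(e,e))⁵` (Wick with ten equal legs). -/
theorem gaussAvg_coord_pow_ten_eq (H : ℕ) {β : ℝ} (hβ : 0 < β) (e : LandauFree H) (c : Fin 3) :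
    gaussAvg β H (fun a => a e c ^ 10) = 945 * ((2 * β)⁻¹ * (hodgeQ H)⁻¹ e e) ^ 5 := by
  have hZ := integral_exp_neg_colourForm_pos (hodgeQ H) (hodgeQ_posDef H) hβ (I := LandauFree H)
  rw [gaussAvg_eq]
  have hnum : ∫ a : LandauFree H → E3, a e c ^ 10 * Real.exp (-(β * ∑ c' : Fin 3, (fun e' => a e' c') ⬝ᵥ (hodgeQ H *ᵥ fun e' => a e' c'))) =
      (∫ a : LandauFree H → E3, Real.exp (-(β * ∑ c' : Fin 3, (fun e' => a e' c') ⬝ᵥ (hodgeQ H *ᵥ fun e' => a e' c')))) *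
        (945 * ((2 * β)⁻¹ * (hodgeQ H)⁻¹ e e) ^ 5) := by
    have h := coldBox_integral_prodCoord_eq_pairingSum H hβ 5 (fun _ => (e, c))
    simp only [Finset.prod_const, Finset.card_univ, Fintype.card_fin] at h
    have h' : ∫ a : LandauFree H → E3, a e c ^ 10 * Real.exp (-(β * ∑ c' : Fin 3, (fun e' => a e' c') ⬝ᵥ (hodgeQ H *ᵥ fun e' => a e' c'))) =
        Real.sqrt (Real.pi / β) ^ Fintype.card (LandauFree H × Fin 3) / Real.sqrt (hodgeQ H ⊗ₖ (1 : Matrix (Fin 3) (Fin 3) ℝ)).det *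
          pairingSum (fun p q : LandauFree H × Fin 3 => (2 * β)⁻¹ * if p.2 = q.2 then (hodgeQ H)⁻¹ p.1 q.1 else 0) 5 (fun _ => (e, c)) := h
    rw [h', Literature.Probability.Distributions.GaussianWick.pairingSum_const, if_pos rfl,
      integral_exp_neg_colourForm (hodgeQ H) (hodgeQ_posDef H) hβ]
    norm_num [Nat.doubleFactorial]
  rw [hnum, mul_div_cancel_left₀ _ hZ.ne']

/-- ★ **Tenth moment of an edge variable**: there is `C` (`= 81·3·945·(C_{S3a}/2)⁵`) with `E₀‖a_e‖¹⁰ ≤ C/β⁵` for all `H ≥ 1`, `β > 0`, `e`. -/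
theorem gaussAvg_norm_pow_ten_le : ∃ C : ℝ, 0 ≤ C ∧ ∀ H : ℕ, 1 ≤ H → ∀ β : ℝ, 0 < β → ∀ e : LandauFree H,
    gaussAvg β H (fun a => ‖a e‖ ^ 10) ≤ C / β ^ 5 := by
  obtain ⟨Cd, hCd⟩ := coldBox_propagator_diag
  have hCd0 : ∀ H : ℕ, 1 ≤ H → ∀ β : ℝ, 0 < β → ∀ e : LandauFree H, 0 ≤ Cd := by
    intro H hH β hβ e
    have h := hCd H hH β hβ (e, 0)
    have h2 : 0 ≤ (2 * β)⁻¹ * Cd := h.1.trans h.2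
    have hβ' : 0 < (2 * β)⁻¹ := by positivity
    nlinarith
  refine ⟨81 * 3 * (945 * (max Cd 0 / 2) ^ 5), by positivity, fun H hH β hβ e => ?_⟩
  have hmax : 0 ≤ max Cd 0 := le_max_right _ _
  -- one colour
  have hc : ∀ c : Fin 3, gaussAvg β H (fun a => a e c ^ 10) ≤ 945 * (max Cd 0 / 2) ^ 5 / β ^ 5 := by
    intro c
    rw [gaussAvg_coord_pow_ten_eq H hβ e c]
    have h := hCd H hH β hβ (e, c)
    rw [if_pos rfl] at h
    have hS : (2 * β)⁻¹ * (hodgeQ H)⁻¹ e e ≤ (max Cd 0 / 2) / β := by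
      calc (2 * β)⁻¹ * (hodgeQ H)⁻¹ e e ≤ (2 * β)⁻¹ * Cd := h.2
        _ ≤ (2 * β)⁻¹ * max Cd 0 := mul_le_mul_of_nonneg_left (le_max_left _ _) (by positivity)
        _ = (max Cd 0 / 2) / β := by field_simp
    have h5 : ((2 * β)⁻¹ * (hodgeQ H)⁻¹ e e) ^ 5 ≤ ((max Cd 0 / 2) / β) ^ 5 := pow_le_pow_left₀ h.1 hS 5
    calc 945 * ((2 * β)⁻¹ * (hodgeQ H)⁻¹ e e) ^ 5 ≤ 945 * ((max Cd 0 / 2) / β) ^ 5 := by linarith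
      _ = 945 * (max Cd 0 / 2) ^ 5 / β ^ 5 := by rw [div_pow]; ring
  -- Jensen + linearity
  have hdom : ∀ a : LandauFree H → E3, ‖a e‖ ^ 10 ≤ 81 * ∑ c : Fin 3, a e c ^ 10 := fun a => norm_pow_ten_le (a e)
  have hint : Integrable (fun a : LandauFree H → E3 => (81 * ∑ c : Fin 3, a e c ^ 10) * gaussWeight β H a) := by
    have h := integrable_finsetSum (Finset.univ : Finset (Fin 3)) fun c _ => (integrable_coord_pow_mul_gaussWeight H hβ e c 10).const_mul 81
    refine h.congr (Filter.Eventually.of_forall fun a => ?_)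
    simp only [Finset.mul_sum, mul_assoc, Finset.sum_mul]
  calc gaussAvg β H (fun a => ‖a e‖ ^ 10) ≤ gaussAvg β H (fun a => 81 * ∑ c : Fin 3, a e c ^ 10) :=
        gaussAvg_mono_of_nonneg H hβ (fun a => by positivity) hdom hint
    _ = 81 * ∑ c : Fin 3, gaussAvg β H (fun a => a e c ^ 10) := by
        rw [gaussAvg_const_mul, gaussAvg_finset_sum _ _ _ _ fun c _ => integrable_coord_pow_mul_gaussWeight H hβ e c 10]
    _ ≤ 81 * ∑ _c : Fin 3, 945 * (max Cd 0 / 2) ^ 5 / β ^ 5 := by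
        refine mul_le_mul_of_nonneg_left (Finset.sum_le_sum fun c _ => hc c) (by norm_num)
    _ = 81 * 3 * (945 * (max Cd 0 / 2) ^ 5) / β ^ 5 := by
        rw [Finset.sum_const, Finset.card_univ, Fintype.card_fin, nsmul_eq_mul]; ring

end EdgeChartGaussian

end Summit.QuantumFields.YangMills.Theorems.AllWindowsColdBoxBoxHighLine

end
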